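import Mathlib
import Summits.QuantumFields.YangMills.Theses.DirichletWindow
import Summits.QuantumFields.YangMills.Theorems.ConvexGribovBodyContinuumLegGivenGapStubLockOfRpCore
import Summits.QuantumFields.YangMills.Theorems.ConvexGribovBodyContinuumLegGivenGapStubRpCore
import HarnessLib

/-!
# `ContinuumFromLatticeGap` (stmt-QuantumFields-15915), line `registered` (reshape 1b): `stub_lockOffE`

Support file for the crux item stmt-QuantumFields-15915
(`Summit.QuantumFields.YangMills.Theses.GronwallGap.ContinuumFromLatticeGap`), registered stub
`stub_lockOffE` of the line `registered` (reshape 1b): **the 17-RP lock OFF the exceptional set**.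

**Statement.** Under `DirichletWindow.XiDiverges` (stmt-QuantumFields-8941, taken as a HYPOTHESIS by
name), at a compact simple `(G, r)` (general Borel σ-algebra) with the crux's hypothesis at `r` — a
locally finite exceptional set `E ⊆ ℝ` (`E ∩ [0, b]` finite for every `b`, possibly unbounded) and,
at every `β > 0` off `E`, some rate `m > 0` with PER-PAIR constants AND PER-PAIR volume thresholds on
the odd tori `(ℤ/(2S+1))⁴`, `n ≤ S` — there are couplings `β_k → +∞`, rates `m̂_k > 0`, PAIR-FREE
thresholds `S₁ k` and a factor `K > 0` with (UNIFORM) one constant per pair for ALL `k` on the tori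
`S ≥ S₁ k`, `n ≤ S`, and (SHARP) no volume-uniform clustering at rate `K m̂_k` at `β_k` beyond any
threshold.

**Proof** (the landed `ContinuumLegGivenGap.stub_lockOfRpCore` of stmt-QuantumFields-15828 with two
changes). (a) *Per-pair threshold absorption*: at one coupling, a per-pair threshold `S ≥ S₀` costs
nothing — below it there are finitely many `(S, n)` with `n ≤ S`, absorbed into the pair constant by
the finite sum `∑_{S<S₀} ∑_{n≤S} |corr_S(n)| e^{m n}`; so at every `β > 0` off `E` the hypothesis is an
admissible rate with threshold `0`. (b) *Couplings off `E`*: with `β₂` from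
`sharp_eventually_of_xiDiverges` at rate `1` and `B := β₂ ∨ 0`, pick `β_k ∈ (B + k, B + k + 1) ∖ E`
(the open interval is infinite, `E ∩ [0, B + k + 1]` is finite); then `β_k > 0`, `β_k ≥ β₂`,
`β_k → +∞`. (c) Verbatim the one-sided diagonal absorption of `stub_lockOfRpCore`: at each `k` an
admissible `M_k ∈ (0, 1)` with `2 M_k` sharp (`exists_admissible_two_mul_sharp`), its threshold
`S₀ k` and per-pair constants; `m̂_k := M_k / 2`, `K := 4`; the RP core `stub_rpCore` gives β-free
pair constants `C A B` at rate `M_k / 2` above box-dependent thresholds `T k Λ₁ Λ₂`; enumerate the box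
pairs `e : ℕ → Finset × Finset` (`exists_surjective_nat`), `S₁ k := S₀ k ∨ ⋁_{j ≤ k} T k (e j)`; for a
pair in box pair `e j` the indices `k ≥ j` are served by the core and the finitely many `k < j` are
absorbed into the constant through the admissibility constants at those `k`.

No definitions, no facts; Mathlib + landed tree lemmas only. [folklore]
-/

noncomputable section

namespace Summit.QuantumFields.YangMills.Theorems.ContinuumFromLatticeGap

open Filter Topology
open Literature.MathematicalPhysics.QuantumFieldTheory
open Literature.MathematicalPhysics.QuantumLattice
open Summit.QuantumFields.YangMills.Theses
open Summit.QuantumFields.YangMills.Theorems.ContinuumLegGivenGap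

/-- **Per-pair threshold absorption** at one coupling and one pair: a volume threshold `S ≥ S₀` in a
torus clustering bound costs nothing — below it there are finitely many `(S, n)` with `n ≤ S`, and the
constant is enlarged by the finite sum `∑_{S<S₀} ∑_{n≤S} |corr_S(n)| e^{m n}` (the one-pair version
of `ContinuumLegGivenGap.stub_thresholdAbsorption`; the conclusion carries the vacuous threshold
`0 ≤ S` in the admissibility shape consumed downstream). [folklore] -/
theorem absorb_pair_threshold {G : Type} [Group G] [TopologicalSpace G] [IsTopologicalGroup G]
    [CompactSpace G] [MeasurableSpace G] [BorelSpace G] (r : LatticeRep G) (β m : ℝ)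
    (A B : YMSpecies G) (C : ℝ) (S₀ : ℕ)
    (hC : ∀ S : ℕ, S₀ ≤ S → ∀ n : ℕ, n ≤ S →
      |latticeConnectedCorr r.ρ β (2 * S + 1) A.F B.F n| ≤ C * Real.exp (-(m * n))) :
    ∃ C' : ℝ, ∀ S n : ℕ, 0 ≤ S → n ≤ S →
      |latticeConnectedCorr r.ρ β (2 * S + 1) A.F B.F n| ≤ C' * Real.exp (-(m * n)) := by
  obtain ⟨D, hD⟩ : ∃ D : ℝ, D = ∑ S ∈ Finset.range S₀, ∑ n ∈ Finset.range (S + 1),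
    |latticeConnectedCorr r.ρ β (2 * S + 1) A.F B.F n| * Real.exp (m * n) := ⟨_, rfl⟩
  refine ⟨max C D, fun S n _ hn => ?_⟩
  have hexp : 0 < Real.exp (-(m * n)) := Real.exp_pos _
  by_cases hS : S₀ ≤ S
  · exact (hC S hS n hn).trans (mul_le_mul_of_nonneg_right (le_max_left _ _) hexp.le)
  · have hS' : S ∈ Finset.range S₀ := Finset.mem_range.2 (lt_of_not_ge hS)
    have hn' : n ∈ Finset.range (S + 1) := Finset.mem_range.2 (Nat.lt_succ_of_le hn)
    have hterm : |latticeConnectedCorr r.ρ β (2 * S + 1) A.F B.F n| * Real.exp (m * n) ≤ D := by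
      have h1 : |latticeConnectedCorr r.ρ β (2 * S + 1) A.F B.F n| * Real.exp (m * n) ≤
          ∑ n' ∈ Finset.range (S + 1),
            |latticeConnectedCorr r.ρ β (2 * S + 1) A.F B.F n'| * Real.exp (m * n') :=
        Finset.single_le_sum (f := fun n' => |latticeConnectedCorr r.ρ β (2 * S + 1) A.F B.F n'| *
          Real.exp (m * n')) (fun n' _ => by positivity) hn'
      rw [hD]
      refine h1.trans ?_
      exact Finset.single_le_sum (f := fun S' => ∑ n' ∈ Finset.range (S' + 1),
          |latticeConnectedCorr r.ρ β (2 * S' + 1) A.F B.F n'| * Real.exp (m * n'))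
        (fun S' _ => Finset.sum_nonneg fun n' _ => by positivity) hS'
    have hkey : |latticeConnectedCorr r.ρ β (2 * S + 1) A.F B.F n| =
        |latticeConnectedCorr r.ρ β (2 * S + 1) A.F B.F n| * Real.exp (m * n) *
          Real.exp (-(m * n)) := by
      rw [mul_assoc, ← Real.exp_add, add_neg_cancel, Real.exp_zero, mul_one]
    rw [hkey]
    exact mul_le_mul_of_nonneg_right (hterm.trans (le_max_right _ _)) hexp.le

/-- **`stub_lockOffE`** (registered stub of stmt-QuantumFields-15915, line `registered`, reshape 1b)
— **the locked IR datum off the exceptional set**: under `DirichletWindow.XiDiverges`, at a compact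
simple `(G, r)` with the crux's hypothesis at `r` (a locally finite `E ⊆ ℝ`; at every `β > 0` off `E`
some rate `m > 0` with PER-PAIR constants and PER-PAIR volume thresholds on the tori `(ℤ/(2S+1))⁴`,
`n ≤ S`), there are couplings `β_k → +∞`, rates `m̂_k > 0`, PAIR-FREE thresholds `S₁ k` and `K > 0`
with (UNIFORM) one constant per pair for ALL `k` and (SHARP) no volume-uniform clustering at rate
`K m̂_k` at `β_k`. Route: per-pair threshold absorption at each `β` (`absorb_pair_threshold`);
`β_k ∈ (B + k, B + k + 1) ∖ E` with `B := β₂ ∨ 0` (`β₂` from `sharp_eventually_of_xiDiverges` at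
rate `1`; the open interval is infinite and `E ∩ [0, B + k + 1]` is finite); then verbatim the landed
`stub_lockOfRpCore`: admissible `M_k ∈ (0, 1)` with `2 M_k` sharp (`exists_admissible_two_mul_sharp`),
`m̂_k := M_k / 2`, `K := 4`, the RP core `stub_rpCore`, enumeration of the box pairs
(`exists_surjective_nat`), `S₁ k :=` the admissibility threshold at `k` `∨` the core thresholds at `k`
of the box pairs `e j`, `j ≤ k`, and the one-sided diagonal absorption of the indices `k < j`.
[folklore] -/
theorem stub_lockOffE :
    DirichletWindow.XiDiverges →
    ∀ (G : Type) [Group G] [TopologicalSpace G] [IsTopologicalGroup G] [CompactSpace G]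
      [MeasurableSpace G] [BorelSpace G], IsCompactSimpleLieGroup G → ∀ r : LatticeRep G,
      (∃ E : Set ℝ, (∀ b : ℝ, (E ∩ Set.Icc 0 b).Finite) ∧ ∀ β : ℝ, 0 < β → β ∉ E → ∃ m : ℝ, 0 < m ∧
        ∀ A B : YMSpecies G, ∃ C : ℝ, ∃ S₀ : ℕ, ∀ S : ℕ, S₀ ≤ S → ∀ n : ℕ, n ≤ S →
          |latticeConnectedCorr r.ρ β (2 * S + 1) A.F B.F n| ≤ C * Real.exp (-(m * n))) →
      ∃ (β : ℕ → ℝ) (mh : ℕ → ℝ) (S₁ : ℕ → ℕ) (K : ℝ), Tendsto β atTop atTop ∧ (∀ k, 0 < mh k) ∧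
        0 < K ∧
        (∀ A B : YMSpecies G, ∃ C : ℝ, ∀ k S n : ℕ, S₁ k ≤ S → n ≤ S →
          |latticeConnectedCorr r.ρ (β k) (2 * S + 1) A.F B.F n| ≤ C * Real.exp (-(mh k * n))) ∧
        (∀ k S₀ : ℕ, ∃ A B : YMSpecies G, ∀ C : ℝ, ∃ S n : ℕ, S₀ ≤ S ∧ n ≤ S ∧
          C * Real.exp (-(K * mh k * n)) <
            |latticeConnectedCorr r.ρ (β k) (2 * S + 1) A.F B.F n|) := by
  intro hXi G _ _ _ _ _ _ hG r hGap
  obtain ⟨E, hE, hGap⟩ := hGap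
  -- the RP core at `r`: β-free pair constants at half of every admissible rate
  obtain ⟨C, hcore⟩ := stub_rpCore G r
  -- rate `1` is sharp at every `β ≥ β₂`
  obtain ⟨β₂, hβ₂⟩ := sharp_eventually_of_xiDiverges hXi hG r 1 one_pos
  -- the base coupling `B ≥ β₂ ∨ 0`
  obtain ⟨Bb, hB2, hBnn⟩ : ∃ Bb : ℝ, β₂ ≤ Bb ∧ 0 ≤ Bb := ⟨max β₂ 0, le_max_left _ _, le_max_right _ _⟩
  have hBk : ∀ k : ℕ, 0 ≤ Bb + k := fun k => add_nonneg hBnn (Nat.cast_nonneg k)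
  -- the couplings `f k ∈ (B + k, B + k + 1) ∖ E`
  have hpick : ∀ k : ℕ, ∃ x : ℝ, Bb + k < x ∧ x ∉ E := fun k => by
    obtain ⟨x, ⟨hx1, hx2⟩, hxE⟩ :=
      (Set.Ioo_infinite (lt_add_one (Bb + k))).exists_notMem_finite (hE (Bb + k + 1))
    exact ⟨x, hx1, fun hx => hxE ⟨hx, (hBk k).trans hx1.le, hx2.le⟩⟩
  choose f hflo hfE using hpick
  have hf0 : ∀ k : ℕ, 0 < f k := fun k => (hBk k).trans_lt (hflo k)
  have hf2 : ∀ k : ℕ, β₂ ≤ f k := fun k =>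
    (hB2.trans (le_add_of_nonneg_right (Nat.cast_nonneg k))).trans (hflo k).le
  have hftend : Tendsto f atTop atTop :=
    tendsto_atTop_mono (fun k => (hflo k).le)
      (tendsto_atTop_add_const_left _ _ tendsto_natCast_atTop_atTop)
  -- at each index: the absorbed clustering (threshold `0`), then an admissible rate `M_k ∈ (0, 1)`
  -- whose double is sharp
  have hsel : ∀ k : ℕ, ∃ M : ℝ, 0 < M ∧ M < 1 ∧
      (∃ S₀ : ℕ, ∀ A B : YMSpecies G, ∃ C' : ℝ, ∀ S n : ℕ, S₀ ≤ S → n ≤ S →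
        |latticeConnectedCorr r.ρ (f k) (2 * S + 1) A.F B.F n| ≤ C' * Real.exp (-(M * n))) ∧
      ∀ S₀ : ℕ, ∃ A B : YMSpecies G, ∀ C' : ℝ, ∃ S n : ℕ, S₀ ≤ S ∧ n ≤ S ∧
        C' * Real.exp (-(2 * M * n)) <
          |latticeConnectedCorr r.ρ (f k) (2 * S + 1) A.F B.F n| := fun k => by
    obtain ⟨m, hm, hAB⟩ := hGap (f k) (hf0 k) (hfE k)
    have hclust : ∀ A B : YMSpecies G, ∃ C' : ℝ, ∀ S n : ℕ, 0 ≤ S → n ≤ S →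
        |latticeConnectedCorr r.ρ (f k) (2 * S + 1) A.F B.F n| ≤ C' * Real.exp (-(m * n)) :=
      fun A B => by
        obtain ⟨C', S₀, hC'⟩ := hAB A B
        exact absorb_pair_threshold r (f k) m A B C' S₀ hC'
    exact exists_admissible_two_mul_sharp r (f k) hm 0 hclust (hβ₂ _ (hf2 k))
  choose M hM0 hM1 hMadm hMsharp using hsel
  -- the admissibility thresholds `S₀ k` and the per-pair admissibility constants `Cadm k A B`
  choose S₀ hS₀ using hMadm
  choose Cadm hCadm using hS₀
  -- the core thresholds `T k Λ₁ Λ₂` at `(β_k, M_k, S₀ k)`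
  have hTex : ∀ (k : ℕ) (Λ₁ Λ₂ : Finset (Literature.MathematicalPhysics.QuantumLattice.ZdEdge 4)),
      ∃ S₁ : ℕ, ∀ A B : YMSpecies G, A.supp = Λ₁ → B.supp = Λ₂ → ∀ S n : ℕ, S₁ ≤ S → n ≤ S →
        |latticeConnectedCorr r.ρ (f k) (2 * S + 1) A.F B.F n| ≤
          C A B * Real.exp (-(M k / 2 * n)) := fun k Λ₁ Λ₂ =>
    hcore (f k) (M k) (S₀ k) (hf0 k).le (hM0 k) (hM1 k).le
      (fun A B => ⟨Cadm k A B, hCadm k A B⟩) Λ₁ Λ₂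
  choose T hT using hTex
  -- enumerate the countably many support-box pairs
  obtain ⟨e, he⟩ := exists_surjective_nat
    (Finset (Literature.MathematicalPhysics.QuantumLattice.ZdEdge 4) ×
      Finset (Literature.MathematicalPhysics.QuantumLattice.ZdEdge 4))
  -- UNIFORM with the pair-free thresholds `S₁ k := S₀ k ∨ ⋁_{j ≤ k} T k (e j)` at rates `M_k / 2`
  have hunif : ∀ A B : YMSpecies G, ∃ C₁ : ℝ, ∀ k S n : ℕ,
      max (S₀ k) ((Finset.range (k + 1)).sup fun j => T k (e j).1 (e j).2) ≤ S → n ≤ S →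
        |latticeConnectedCorr r.ρ (f k) (2 * S + 1) A.F B.F n| ≤
          C₁ * Real.exp (-(M k / 2 * n)) := by
    intro A B
    obtain ⟨j, hj⟩ := he (A.supp, B.supp)
    have hj1 : A.supp = (e j).1 := by rw [hj]
    have hj2 : B.supp = (e j).2 := by rw [hj]
    refine ⟨max (C A B) 0 + ∑ k ∈ Finset.range j, max (Cadm k A B) 0, fun k S n hS hn => ?_⟩
    have hsum0 : 0 ≤ ∑ k' ∈ Finset.range j, max (Cadm k' A B) 0 :=
      Finset.sum_nonneg fun k' _ => le_max_right _ _
    have hexp0 : 0 ≤ Real.exp (-(M k / 2 * n)) := (Real.exp_pos _).le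
    rcases le_or_gt j k with hjk | hkj
    · -- `j ≤ k`: the core threshold of the box pair `e j` at index `k` is below `S₁ k`
      have hTS : T k (e j).1 (e j).2 ≤ S :=
        le_trans (le_trans (Finset.le_sup (f := fun j' => T k (e j').1 (e j').2)
          (Finset.mem_range.2 (Nat.lt_succ_of_le hjk))) (le_max_right _ _)) hS
      calc |latticeConnectedCorr r.ρ (f k) (2 * S + 1) A.F B.F n|
          ≤ C A B * Real.exp (-(M k / 2 * n)) := hT k _ _ A B hj1 hj2 S n hTS hn
        _ ≤ (max (C A B) 0 + ∑ k' ∈ Finset.range j, max (Cadm k' A B) 0) *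
              Real.exp (-(M k / 2 * n)) :=
            mul_le_mul_of_nonneg_right ((le_max_left _ _).trans (le_add_of_nonneg_right hsum0))
              hexp0
    · -- `k < j`: absorbed into the constant through the admissibility constant at `k`
      have hS0 : S₀ k ≤ S := le_trans (le_max_left _ _) hS
      have hrate : Real.exp (-(M k * n)) ≤ Real.exp (-(M k / 2 * n)) :=
        Real.exp_le_exp.2 (neg_le_neg (mul_le_mul_of_nonneg_right (half_le_self (hM0 k).le)
          (Nat.cast_nonneg n)))
      have hle : max (Cadm k A B) 0 ≤
          max (C A B) 0 + ∑ k' ∈ Finset.range j, max (Cadm k' A B) 0 :=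
        le_trans (Finset.single_le_sum (f := fun k' => max (Cadm k' A B) 0)
          (fun k' _ => le_max_right _ _) (Finset.mem_range.2 hkj))
          (le_add_of_nonneg_left (le_max_right _ _))
      calc |latticeConnectedCorr r.ρ (f k) (2 * S + 1) A.F B.F n|
          ≤ Cadm k A B * Real.exp (-(M k * n)) := hCadm k A B S n hS0 hn
        _ ≤ max (Cadm k A B) 0 * Real.exp (-(M k / 2 * n)) :=
            (mul_le_mul_of_nonneg_right (le_max_left _ _) (Real.exp_pos _).le).trans
              (mul_le_mul_of_nonneg_left hrate (le_max_right _ _))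
        _ ≤ (max (C A B) 0 + ∑ k' ∈ Finset.range j, max (Cadm k' A B) 0) *
              Real.exp (-(M k / 2 * n)) := mul_le_mul_of_nonneg_right hle hexp0
  -- SHARP at rate `4 · (M_k / 2) = 2 M_k`
  have hsharp : ∀ k S' : ℕ, ∃ A B : YMSpecies G, ∀ C' : ℝ, ∃ S n : ℕ, S' ≤ S ∧ n ≤ S ∧
      C' * Real.exp (-(4 * (M k / 2) * n)) <
        |latticeConnectedCorr r.ρ (f k) (2 * S + 1) A.F B.F n| := fun k S' => by
    have h : (4 : ℝ) * (M k / 2) = 2 * M k := by ring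
    rw [h]
    exact hMsharp k S'
  exact ⟨f, fun k => M k / 2,
    fun k => max (S₀ k) ((Finset.range (k + 1)).sup fun j => T k (e j).1 (e j).2), 4,
    hftend, fun k => half_pos (hM0 k), four_pos, hunif, hsharp⟩

end Summit.QuantumFields.YangMills.Theorems.ContinuumFromLatticeGap

end
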